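import Mathlib
import Summits.AtomisticToContinuum.HydrodynamicLimit.Theorems.ImplosionDichotomyDenseExcursionSonicRealBoundEnergy

/-!
# The weighted energy FLUX inequality of the cavity resolvent with a source
# (crux `DenseExcursion`, line `sonic-cavity-renewal`, bricks for stub `stub_cavityResolventCk`, theorem T7(iii))

Helper file (`--supports stmt-AtomisticToContinuum-12586`, line lead a2, stub-worker E3 for `stub_cavityResolventCk`,
the ENERGY REGIME `Re Λ → +∞` of the uniform weighted resolvent bound).

**Mathematics.** For a solution `v = (ŵ, ŝ)` of the resolvent equations `Λ ŵ − linW = f`, `Λ ŝ − linS = g` on `x ≤ 1`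
the weighted energy of `…SonicRealBoundEnergy` (symmetriser `diag(1, 9)`, weight `e^{5x}`),
`E = e^{5x}((W−1)|ŵ|² + 6S Re(ŵ conj ŝ) + 9(W−1)|ŝ|²) = e^{5x}(c₊|p|² + c₋|m|²)/2` (`p = ŵ + 3ŝ`, `m = ŵ − 3ŝ`,
`c± = W − 1 ± S`: `E` is the acoustic energy FLUX through the sphere of radius `eˣ`), satisfies the SOURCED identity
`E′ = e^{5x}(2 Re Λ·N_H − Q₂ − 2 Re(ŵ f̄) − 18 Re(ŝ ḡ))`, `N_H = |ŵ|² + 9|ŝ|²` (`energy_alg_src`, pure algebra), hence with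
the tube bound `Q₂ ≤ 6 N_H` and Cauchy–Schwarz, for `Re Λ > 3` and a source with `|f| + eˣ|g| ≤ N` on `x ≤ 1`,
`E′ ≥ −N²(e^{5x} + 9e^{3x})/(Re Λ − 3)`. So `G = E + N²(e^{5x}/5 + 3e^{3x})/(Re Λ − 3)` is monotone on `(−∞, 1]`; for a
pair with finite weighted sup (`|ŵ| + eˣ|ŝ| ≤ B`) both `E` and the correction tend to `0` at `−∞`, so `G ≥ 0` on `x ≤ 1`:

  `(1 − W + S)|m|² ≤ (W − 1 + S)|p|² + 2N²(1/5 + 3e^{−2x})/(Re Λ − 3)`   (`cavity_energy_flux`).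

This is the REFLECTION BOUND AT THE CENTRE, uniformly in `Im Λ`: the outgoing acoustic family `m` is controlled pointwise by
the incoming one `p` plus the work of the source inside the sphere — in particular on `0 ≤ x ≤ 1` (`c₊ ≤ 0`) both families
are bounded outright by `N/√(Re Λ − 3)`. It replaces the inner Bessel analysis of the centre for the energy regime.
Sources: folklore (Courant–Friedrichs 1948 §§3–4, energy flux of linear acoustics); the identity is `realBound_energy_alg`
with sources. NOT here: the transport (barrier) half of the estimate and the assembly (next files of worker E3).
-/

noncomputable section

open Filter Set
open scoped Topology ContDiff

namespace Summit.AtomisticToContinuum.HydrodynamicLimit.Theorems.SonicCavityRenewal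

open Summit.AtomisticToContinuum.HydrodynamicLimit.Theorems.R2OneModeTwoConditions

/-! ## The algebraic identity with a source -/

/-- PURE ALGEBRA: the weighted energy identity with symmetriser `diag(1, 9)`, weight derivative `w′ = 5w` AND A SOURCE
`(f₁ + i f₂, g₁ + i g₂)`: the raw derivative of `((W−1)|a|² + 6S a·b + 9(W−1)|b|²)·w` equals
`(2 Lr (|a|² + 9|b|²) − Q₂ − 2(a·f) − 18(b·g))·w`. [folklore] -/
theorem energy_alg_src (W W' S S' a₁ a₂ b₁ b₂ a₁' a₂' b₁' b₂' Lr Li r w f₁ f₂ g₁ g₂ : ℝ)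
    (h1 : (W - 1) * a₁' + 3 * S * b₁' + (W' + 2 * W - r) * a₁ + (3 * S' + 6 * S) * b₁ = Lr * a₁ - Li * a₂ - f₁)
    (h2 : (W - 1) * a₂' + 3 * S * b₂' + (W' + 2 * W - r) * a₂ + (3 * S' + 6 * S) * b₂ = Lr * a₂ + Li * a₁ - f₂)
    (h3 : S / 3 * a₁' + (W - 1) * b₁' + (S' + 2 * S) * a₁ + (W' / 3 + 2 * W - r) * b₁ = Lr * b₁ - Li * b₂ - g₁)
    (h4 : S / 3 * a₂' + (W - 1) * b₂' + (S' + 2 * S) * a₂ + (W' / 3 + 2 * W - r) * b₂ = Lr * b₂ + Li * b₁ - g₂) :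
    5 * w * ((W - 1) * (a₁ * a₁ + a₂ * a₂) + 6 * S * (a₁ * b₁ + a₂ * b₂) + 9 * (W - 1) * (b₁ * b₁ + b₂ * b₂))
      + w * (W' * (a₁ * a₁ + a₂ * a₂) + (W - 1) * (a₁' * a₁ + a₁ * a₁' + (a₂' * a₂ + a₂ * a₂'))
        + (6 * S' * (a₁ * b₁ + a₂ * b₂) + 6 * S * (a₁' * b₁ + a₁ * b₁' + (a₂' * b₂ + a₂ * b₂')))
        + (9 * W' * (b₁ * b₁ + b₂ * b₂) + 9 * (W - 1) * (b₁' * b₁ + b₁ * b₁' + (b₂' * b₂ + b₂ * b₂'))))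
    = w * (2 * Lr * (a₁ * a₁ + a₂ * a₂ + 9 * (b₁ * b₁ + b₂ * b₂))
        - ((W' - W + 5 - 2 * r) * (a₁ * a₁ + a₂ * a₂) + 18 * (S + S') * (a₁ * b₁ + a₂ * b₂)
          + (-3 * W' - 9 * W + 45 - 18 * r) * (b₁ * b₁ + b₂ * b₂))
        - (2 * (a₁ * f₁ + a₂ * f₂) + 18 * (b₁ * g₁ + b₂ * g₂))) := by
  linear_combination (2 * a₁ * w) * h1 + (2 * a₂ * w) * h2 + (18 * b₁ * w) * h3 + (18 * b₂ * w) * h4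

/-- The four REAL resolvent equations: real and imaginary parts of `Λ ŵ − linW = f`, `Λ ŝ − linS = g` (the operator has
real coefficients). [folklore] -/
theorem resolventEqs_real {r : ℝ} {W S : ℝ → ℝ} {Λ : ℂ} {ŵ ŝ f g : ℝ → ℂ} {x : ℝ}
    (h₁ : Λ * ŵ x - linW r W S ŵ ŝ x = f x) (h₂ : Λ * ŝ x - linS r W S ŵ ŝ x = g x) :
    ((W x - 1) * (deriv ŵ x).re + 3 * S x * (deriv ŝ x).re + (deriv W x + 2 * W x - r) * (ŵ x).re
        + (3 * deriv S x + 6 * S x) * (ŝ x).re = Λ.re * (ŵ x).re - Λ.im * (ŵ x).im - (f x).re) ∧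
    ((W x - 1) * (deriv ŵ x).im + 3 * S x * (deriv ŝ x).im + (deriv W x + 2 * W x - r) * (ŵ x).im
        + (3 * deriv S x + 6 * S x) * (ŝ x).im = Λ.re * (ŵ x).im + Λ.im * (ŵ x).re - (f x).im) ∧
    (S x / 3 * (deriv ŵ x).re + (W x - 1) * (deriv ŝ x).re + (deriv S x + 2 * S x) * (ŵ x).re
        + (deriv W x / 3 + 2 * W x - r) * (ŝ x).re = Λ.re * (ŝ x).re - Λ.im * (ŝ x).im - (g x).re) ∧
    (S x / 3 * (deriv ŵ x).im + (W x - 1) * (deriv ŝ x).im + (deriv S x + 2 * S x) * (ŵ x).im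
        + (deriv W x / 3 + 2 * W x - r) * (ŝ x).im = Λ.re * (ŝ x).im + Λ.im * (ŝ x).re - (g x).im) := by
  have e1 := congrArg Complex.re h₁
  have e2 := congrArg Complex.im h₁
  have e3 := congrArg Complex.re h₂
  have e4 := congrArg Complex.im h₂
  simp only [linW, linS, Complex.sub_re, Complex.sub_im, Complex.add_re, Complex.add_im, Complex.mul_re,
    Complex.mul_im, Complex.ofReal_re, Complex.ofReal_im, zero_mul, sub_zero, add_zero] at e1 e2 e3 e4
  exact ⟨by linarith, by linarith, by linarith, by linarith⟩

/-! ## The pointwise sourced energy identity -/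

/-- THE SOURCED WEIGHTED ENERGY IDENTITY at a point: for `W, S, ŵ, ŝ` differentiable at `x` and the resolvent equations
holding AT `x`, the energy `E(y) = e^{5y}((W−1)|ŵ|² + 6S Re(ŵ conj ŝ) + 9(W−1)|ŝ|²)` has derivative
`e^{5x}(2 Re Λ N_H − Q₂ − 2 Re(ŵ f̄) − 18 Re(ŝ ḡ))` at `x` (real/imaginary coordinates). [folklore] -/
theorem energy_hasDerivAt_src {r : ℝ} {W S : ℝ → ℝ} {Λ : ℂ} {ŵ ŝ f g : ℝ → ℂ} {x : ℝ}
    (hW : DifferentiableAt ℝ W x) (hS : DifferentiableAt ℝ S x) (hŵ : DifferentiableAt ℝ ŵ x)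
    (hŝ : DifferentiableAt ℝ ŝ x)
    (h : Λ * ŵ x - linW r W S ŵ ŝ x = f x ∧ Λ * ŝ x - linS r W S ŵ ŝ x = g x) :
    HasDerivAt (fun y => Real.exp (5 * y) * ((W y - 1) * ((ŵ y).re * (ŵ y).re + (ŵ y).im * (ŵ y).im)
        + 6 * S y * ((ŵ y).re * (ŝ y).re + (ŵ y).im * (ŝ y).im)
        + 9 * (W y - 1) * ((ŝ y).re * (ŝ y).re + (ŝ y).im * (ŝ y).im)))
      (Real.exp (5 * x) * (2 * Λ.re * ((ŵ x).re * (ŵ x).re + (ŵ x).im * (ŵ x).im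
          + 9 * ((ŝ x).re * (ŝ x).re + (ŝ x).im * (ŝ x).im))
        - ((deriv W x - W x + 5 - 2 * r) * ((ŵ x).re * (ŵ x).re + (ŵ x).im * (ŵ x).im)
          + 18 * (S x + deriv S x) * ((ŵ x).re * (ŝ x).re + (ŵ x).im * (ŝ x).im)
          + (-3 * deriv W x - 9 * W x + 45 - 18 * r) * ((ŝ x).re * (ŝ x).re + (ŝ x).im * (ŝ x).im))
        - (2 * ((ŵ x).re * (f x).re + (ŵ x).im * (f x).im)
          + 18 * ((ŝ x).re * (g x).re + (ŝ x).im * (g x).im))))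
      x := by
  obtain ⟨h1, h2, h3, h4⟩ := resolventEqs_real h.1 h.2
  have ha₁ := hasDerivAt_re_comp hŵ.hasDerivAt
  have ha₂ := hasDerivAt_im_comp hŵ.hasDerivAt
  have hb₁ := hasDerivAt_re_comp hŝ.hasDerivAt
  have hb₂ := hasDerivAt_im_comp hŝ.hasDerivAt
  have hW1 : HasDerivAt (fun y => W y - 1) (deriv W x) x := hW.hasDerivAt.sub_const 1
  have hS6 : HasDerivAt (fun y => 6 * S y) (6 * deriv S x) x := hS.hasDerivAt.const_mul 6
  have hW9 : HasDerivAt (fun y => 9 * (W y - 1)) (9 * deriv W x) x := hW1.const_mul 9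
  have hexp : HasDerivAt (fun y => Real.exp (5 * y)) (5 * Real.exp (5 * x)) x := by
    have h := ((hasDerivAt_id' x).const_mul 5).exp
    simpa [mul_comm] using h
  have hraw := hexp.fun_mul (((hW1.fun_mul ((ha₁.fun_mul ha₁).fun_add (ha₂.fun_mul ha₂))).fun_add
    (hS6.fun_mul ((ha₁.fun_mul hb₁).fun_add (ha₂.fun_mul hb₂)))).fun_add
      (hW9.fun_mul ((hb₁.fun_mul hb₁).fun_add (hb₂.fun_mul hb₂))))
  refine hraw.congr_deriv ?_
  rw [energy_alg_src (W x) (deriv W x) (S x) (deriv S x) (ŵ x).re (ŵ x).im (ŝ x).re (ŝ x).im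
    (deriv ŵ x).re (deriv ŵ x).im (deriv ŝ x).re (deriv ŝ x).im Λ.re Λ.im r (Real.exp (5 * x))
    (f x).re (f x).im (g x).re (g x).im h1 h2 h3 h4]

/-! ## Elementary inequalities -/

/-- Cauchy–Schwarz/AM–GM for the source term: `(X−3)(2 a·f + 18 b·g) ≤ (X−3)²(|a|² + 9|b|²) + (|f|² + 9|g|²)`.
[folklore] -/
theorem energy_src_le (X a₁ a₂ b₁ b₂ f₁ f₂ g₁ g₂ : ℝ) :
    (X - 3) * (2 * (a₁ * f₁ + a₂ * f₂) + 18 * (b₁ * g₁ + b₂ * g₂))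
      ≤ (X - 3) ^ 2 * (a₁ * a₁ + a₂ * a₂ + 9 * (b₁ * b₁ + b₂ * b₂)) + (f₁ * f₁ + f₂ * f₂ + 9 * (g₁ * g₁ + g₂ * g₂)) := by
  nlinarith [sq_nonneg ((X - 3) * a₁ - f₁), sq_nonneg ((X - 3) * a₂ - f₂), sq_nonneg ((X - 3) * b₁ - g₁),
    sq_nonneg ((X - 3) * b₂ - g₂)]

/-- The energy density in characteristic form: `(W−1)|ŵ|² + 6S Re(ŵ conj ŝ) + 9(W−1)|ŝ|² = (c₊|ŵ + 3ŝ|² + c₋|ŵ − 3ŝ|²)/2`,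
`c± = W − 1 ± S`. [folklore] -/
theorem energy_density_char (W S : ℝ) (ŵ ŝ : ℂ) :
    (W - 1) * (ŵ.re * ŵ.re + ŵ.im * ŵ.im) + 6 * S * (ŵ.re * ŝ.re + ŵ.im * ŝ.im)
        + 9 * (W - 1) * (ŝ.re * ŝ.re + ŝ.im * ŝ.im)
      = ((W - 1 + S) * ‖ŵ + 3 * ŝ‖ ^ 2 + (W - 1 - S) * ‖ŵ - 3 * ŝ‖ ^ 2) / 2 := by
  rw [Complex.sq_norm, Complex.sq_norm, Complex.normSq_apply, Complex.normSq_apply]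
  simp only [Complex.add_re, Complex.add_im, Complex.sub_re, Complex.sub_im, Complex.mul_re, Complex.mul_im]
  norm_num
  ring

/-- The scalar core of the lower bound `E′ ≥ −e^{5x}(|f|² + 9|g|²)/(Re Λ − 3)`: with `A9 = |ŵ|² + 9|ŝ|² ≥ 0`,
`Q₂ ≤ 6 A9` and the Cauchy–Schwarz bound of `energy_src_le`, `(X − 3)·w(2X A9 − Q₂ − Src) ≥ −w(|f|² + 9|g|²)`. [folklore] -/
theorem energy_key_ineq (X w A9 Q Src FG : ℝ) (hX : 0 ≤ X - 3) (hw : 0 ≤ w) (hA : 0 ≤ A9) (hQ : Q ≤ 6 * A9)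
    (hCS : (X - 3) * Src ≤ (X - 3) ^ 2 * A9 + FG) : -(w * FG) ≤ (X - 3) * (w * (2 * X * A9 - Q - Src)) := by
  have h6 : 0 ≤ (X - 3) * (6 * A9 - Q) := mul_nonneg hX (by linarith)
  have hsq : 0 ≤ (X - 3) ^ 2 * A9 := by positivity
  have h1 : -FG ≤ (X - 3) * (2 * X * A9 - Q - Src) := by nlinarith
  have h2 := mul_le_mul_of_nonneg_left h1 hw
  calc -(w * FG) = w * -FG := by ring
    _ ≤ w * ((X - 3) * (2 * X * A9 - Q - Src)) := h2
    _ = (X - 3) * (w * (2 * X * A9 - Q - Src)) := by ring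

/-! ## The flux inequality -/

/-- **Registered helper `cavity_energy_flux` (worker E3, theorem T7(iii) of `stub_cavityResolventCk`): THE WEIGHTED ENERGY
FLUX INEQUALITY WITH A SOURCE.** For a monatomic tube profile, `Re Λ > 3`, a differentiable pair `(ŵ, ŝ)` with FINITE
weighted sup `|ŵ| + eˣ|ŝ| ≤ B` on `x ≤ 1` solving the resolvent equations with source `(f, g)`, `|f| + eˣ|g| ≤ N` on `x ≤ 1`,
one has at every `x ≤ 1`
`(1 − W + S)|ŵ − 3ŝ|² ≤ (W − 1 + S)|ŵ + 3ŝ|² + 2N²(1/5 + 3e^{−2x})/(Re Λ − 3)`: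
the outgoing acoustic family is bounded by the incoming one plus the work of the source inside radius `eˣ`, uniformly
in `Im Λ` (and `B` does not enter). [folklore] -/
theorem cavity_energy_flux : ∀ (r : ℝ) (W S : ℝ → ℝ), IsMonatomicProfile r W S → CavityTube r W S → ∀ (Λ : ℂ) (f g ŵ ŝ : ℝ → ℂ) (N B : ℝ), 3 < Λ.re → Differentiable ℝ ŵ → Differentiable ℝ ŝ → (∀ x, x ≤ 1 → Λ * ŵ x - linW r W S ŵ ŝ x = f x ∧ Λ * ŝ x - linS r W S ŵ ŝ x = g x) → (∀ x, x ≤ 1 → ‖f x‖ + Real.exp x * ‖g x‖ ≤ N) → (∀ x, x ≤ 1 → ‖ŵ x‖ + Real.exp x * ‖ŝ x‖ ≤ B) → ∀ x, x ≤ 1 → (1 - W x + S x) * ‖ŵ x - 3 * ŝ x‖ ^ 2 ≤ (W x - 1 + S x) * ‖ŵ x + 3 * ŝ x‖ ^ 2 + 2 * N ^ 2 * (1 / 5 + 3 * Real.exp (-2 * x)) / (Λ.re - 3) := by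
  intro r W S hP hT Λ f g ŵ ŝ N B hX hŵ hŝ hsol hsrc hB x hx
  obtain ⟨hr, -, hW, hS, hSpos, -⟩ := hP
  obtain ⟨-, -, -, -, -, -, hang, hWenv, hSenv, -⟩ := hT
  have hW1 : Differentiable ℝ W := hW.differentiable (by simp)
  have hS1 : Differentiable ℝ S := hS.differentiable (by simp)
  set X : ℝ := Λ.re with hXdef
  have hX3 : 0 < X - 3 := by linarith
  have hnorm : ∀ z : ℂ, ‖z‖ ^ 2 = z.re * z.re + z.im * z.im := fun z => by
    rw [Complex.sq_norm, Complex.normSq_apply]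
  -- the energy and its corrected version
  set E : ℝ → ℝ := fun y => Real.exp (5 * y) * ((W y - 1) * ((ŵ y).re * (ŵ y).re + (ŵ y).im * (ŵ y).im)
        + 6 * S y * ((ŵ y).re * (ŝ y).re + (ŵ y).im * (ŝ y).im)
        + 9 * (W y - 1) * ((ŝ y).re * (ŝ y).re + (ŝ y).im * (ŝ y).im)) with hE
  set E' : ℝ → ℝ := fun y => Real.exp (5 * y) * (2 * Λ.re * ((ŵ y).re * (ŵ y).re + (ŵ y).im * (ŵ y).im
          + 9 * ((ŝ y).re * (ŝ y).re + (ŝ y).im * (ŝ y).im))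
        - ((deriv W y - W y + 5 - 2 * r) * ((ŵ y).re * (ŵ y).re + (ŵ y).im * (ŵ y).im)
          + 18 * (S y + deriv S y) * ((ŵ y).re * (ŝ y).re + (ŵ y).im * (ŝ y).im)
          + (-3 * deriv W y - 9 * W y + 45 - 18 * r) * ((ŝ y).re * (ŝ y).re + (ŝ y).im * (ŝ y).im))
        - (2 * ((ŵ y).re * (f y).re + (ŵ y).im * (f y).im)
          + 18 * ((ŝ y).re * (g y).re + (ŝ y).im * (g y).im))) with hE'
  set G : ℝ → ℝ := fun y => E y + N ^ 2 * (Real.exp (5 * y) / 5 + 3 * Real.exp (3 * y)) / (X - 3) with hG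
  set G' : ℝ → ℝ := fun y => E' y + N ^ 2 * (Real.exp (5 * y) + 9 * Real.exp (3 * y)) / (X - 3) with hG'
  have hEd : ∀ y, y ≤ 1 → HasDerivAt E (E' y) y := fun y hy =>
    energy_hasDerivAt_src (hW1 y) (hS1 y) (hŵ y) (hŝ y) (hsol y hy)
  have hcorr : ∀ y, HasDerivAt (fun y => N ^ 2 * (Real.exp (5 * y) / 5 + 3 * Real.exp (3 * y)) / (X - 3))
      (N ^ 2 * (Real.exp (5 * y) + 9 * Real.exp (3 * y)) / (X - 3)) y := by
    intro y
    have h5 : HasDerivAt (fun y => Real.exp (5 * y)) (Real.exp (5 * y) * 5) y := by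
      simpa using ((hasDerivAt_id' y).const_mul 5).exp
    have h3 : HasDerivAt (fun y => Real.exp (3 * y)) (Real.exp (3 * y) * 3) y := by
      simpa using ((hasDerivAt_id' y).const_mul 3).exp
    have h := (((h5.div_const 5).add (h3.const_mul 3)).const_mul (N ^ 2)).div_const (X - 3)
    refine h.congr_deriv ?_
    ring
  have hGd : ∀ y, y ≤ 1 → HasDerivAt G (G' y) y := fun y hy => (hEd y hy).add (hcorr y)
  -- the derivative of `G` is non-negative on `y ≤ 1`
  have hG'pos : ∀ y, y ≤ 1 → 0 ≤ G' y := by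
    intro y hy
    obtain ⟨hWy, hW'y, -⟩ := hWenv y hy
    have hσ : |S y + deriv S y| ≤ 5 / 8 := by
      have h := hang y hy
      obtain ⟨h₁, h₂⟩ := abs_le.mp hWy
      exact abs_le.mpr ⟨by linarith [neg_abs_le (S y + deriv S y)], by linarith [le_abs_self (S y + deriv S y)]⟩
    have hQ := realBound_Q_le (W y) (deriv W y) (S y + deriv S y) r (ŵ y).re (ŵ y).im (ŝ y).re (ŝ y).im
      hWy hW'y hσ hr
    have hCS := energy_src_le X (ŵ y).re (ŵ y).im (ŝ y).re (ŝ y).im (f y).re (f y).im (g y).re (g y).im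
    -- source sizes
    have hfg := hsrc y hy
    have hf0 : 0 ≤ ‖f y‖ := norm_nonneg _
    have hg0 : 0 ≤ ‖g y‖ := norm_nonneg _
    have hey : 0 < Real.exp y := Real.exp_pos y
    have hfN : ‖f y‖ ≤ N := by nlinarith
    have hgN : Real.exp y * ‖g y‖ ≤ N := by linarith
    have hN0 : 0 ≤ N := hf0.trans hfN
    have hf2 : (f y).re * (f y).re + (f y).im * (f y).im ≤ N ^ 2 := by
      rw [← hnorm]; exact pow_le_pow_left₀ hf0 hfN 2
    have hg2 : Real.exp (2 * y) * ((g y).re * (g y).re + (g y).im * (g y).im) ≤ N ^ 2 := by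
      rw [← hnorm]
      have : Real.exp (2 * y) = Real.exp y ^ 2 := by rw [← Real.exp_nat_mul]; norm_num
      rw [this, ← mul_pow]
      exact pow_le_pow_left₀ (by positivity) hgN 2
    -- assemble
    have hA9 : 0 ≤ (ŵ y).re * (ŵ y).re + (ŵ y).im * (ŵ y).im + 9 * ((ŝ y).re * (ŝ y).re + (ŝ y).im * (ŝ y).im) := by
      nlinarith [mul_self_nonneg (ŵ y).re, mul_self_nonneg (ŵ y).im, mul_self_nonneg (ŝ y).re,
        mul_self_nonneg (ŝ y).im]
    have hw : 0 < Real.exp (5 * y) := Real.exp_pos _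
    have he3 : Real.exp (5 * y) = Real.exp (3 * y) * Real.exp (2 * y) := by
      rw [← Real.exp_add]; congr 1; ring
    have he3pos : 0 < Real.exp (3 * y) := Real.exp_pos _
    have hkey := energy_key_ineq X (Real.exp (5 * y)) _ _ _ _ hX3.le hw.le hA9 hQ hCS
    have h2 : Real.exp (5 * y) * ((f y).re * (f y).re + (f y).im * (f y).im +
        9 * ((g y).re * (g y).re + (g y).im * (g y).im)) ≤ N ^ 2 * (Real.exp (5 * y) + 9 * Real.exp (3 * y)) := by
      have t1 := mul_le_mul_of_nonneg_left hf2 hw.le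
      have t2 := mul_le_mul_of_nonneg_left hg2 he3pos.le
      calc Real.exp (5 * y) * ((f y).re * (f y).re + (f y).im * (f y).im +
            9 * ((g y).re * (g y).re + (g y).im * (g y).im))
          = Real.exp (5 * y) * ((f y).re * (f y).re + (f y).im * (f y).im) +
            9 * (Real.exp (3 * y) * (Real.exp (2 * y) * ((g y).re * (g y).re + (g y).im * (g y).im))) := by
            rw [he3]; ring
        _ ≤ Real.exp (5 * y) * N ^ 2 + 9 * (Real.exp (3 * y) * N ^ 2) := by linarith
        _ = N ^ 2 * (Real.exp (5 * y) + 9 * Real.exp (3 * y)) := by ring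
    have key : 0 ≤ (X - 3) * G' y := by
      have hXre : Λ.re = X := rfl
      have hdiv : (X - 3) * (N ^ 2 * (Real.exp (5 * y) + 9 * Real.exp (3 * y)) / (X - 3)) =
          N ^ 2 * (Real.exp (5 * y) + 9 * Real.exp (3 * y)) := by
        field_simp
      have hsplit : (X - 3) * G' y = (X - 3) * E' y + (X - 3) * (N ^ 2 * (Real.exp (5 * y) +
          9 * Real.exp (3 * y)) / (X - 3)) := by
        simp only [hG']; ring
      rw [hsplit, hdiv]
      have hE'y : (X - 3) * E' y = (X - 3) * (Real.exp (5 * y) * (2 * X * ((ŵ y).re * (ŵ y).re +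
          (ŵ y).im * (ŵ y).im + 9 * ((ŝ y).re * (ŝ y).re + (ŝ y).im * (ŝ y).im)) -
          ((deriv W y - W y + 5 - 2 * r) * ((ŵ y).re * (ŵ y).re + (ŵ y).im * (ŵ y).im) +
          18 * (S y + deriv S y) * ((ŵ y).re * (ŝ y).re + (ŵ y).im * (ŝ y).im) +
          (-3 * deriv W y - 9 * W y + 45 - 18 * r) * ((ŝ y).re * (ŝ y).re + (ŝ y).im * (ŝ y).im)) -
          (2 * ((ŵ y).re * (f y).re + (ŵ y).im * (f y).im) +
            18 * ((ŝ y).re * (g y).re + (ŝ y).im * (g y).im)))) := by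
        simp only [hE', hXre]
      rw [hE'y]
      linarith
    exact (mul_nonneg_iff_of_pos_left hX3).mp key
  -- `G` is monotone on `(-∞, 1]`
  have hGcont : ∀ y, y ≤ 1 → ContinuousAt G y := fun y hy => (hGd y hy).continuousAt
  have hmono : MonotoneOn G (Iic 1) :=
    monotoneOn_of_hasDerivWithinAt_nonneg (convex_Iic 1) (fun y hy => (hGcont y hy).continuousWithinAt)
      (fun y hy => (hGd y (by rw [interior_Iic] at hy; exact le_of_lt hy)).hasDerivWithinAt)
      fun y hy => hG'pos y (by rw [interior_Iic] at hy; exact le_of_lt hy)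
  -- `G` is bounded below near `-∞` by a quantity tending to `0`
  have hB0 : 0 ≤ B := by
    have h := hB 0 (by norm_num)
    have : 0 ≤ ‖ŵ 0‖ + Real.exp 0 * ‖ŝ 0‖ := by positivity
    linarith
  have hlow : ∀ y, y ≤ 0 → -(15 * B ^ 2 * (Real.exp (4 * y) + Real.exp (2 * y))) ≤ G y := by
    intro y hy
    obtain ⟨hWy, -, -⟩ := hWenv y (by linarith)
    obtain ⟨-, hS1y, -, -⟩ := hSenv y (by linarith)
    have hm : 1 ≤ Real.exp (-y) := Real.one_le_exp (by linarith)
    have hsm : S y ≤ Real.exp (-y) := by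
      have h := mul_le_mul_of_nonneg_left hS1y (Real.exp_pos (-y)).le
      rwa [← mul_assoc, ← Real.exp_add, show -y + y = 0 by ring, Real.exp_zero, one_mul, mul_one] at h
    have hP : |(ŵ y).re * (ŝ y).re + (ŵ y).im * (ŝ y).im| ≤
        (((ŵ y).re * (ŵ y).re + (ŵ y).im * (ŵ y).im) + ((ŝ y).re * (ŝ y).re + (ŝ y).im * (ŝ y).im)) / 2 :=
      abs_le.mpr ⟨by nlinarith [sq_nonneg ((ŵ y).re + (ŝ y).re), sq_nonneg ((ŵ y).im + (ŝ y).im)],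
        by nlinarith [sq_nonneg ((ŵ y).re - (ŝ y).re), sq_nonneg ((ŵ y).im - (ŝ y).im)]⟩
    have h := realBound_energy_abs_le (W y) (S y) (Real.exp (-y)) (Real.exp (5 * y)) _ _ _ hWy (hSpos y) hsm hm
      (Real.exp_pos _).le (add_nonneg (mul_self_nonneg _) (mul_self_nonneg _))
      (add_nonneg (mul_self_nonneg _) (mul_self_nonneg _)) hP
    rw [← Real.exp_add, show 5 * y + -y = 4 * y by ring] at h
    -- sizes of `ŵ`, `ŝ` at `y`
    have hby := hB y (by linarith)
    have hw0 : 0 ≤ ‖ŵ y‖ := norm_nonneg _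
    have hs0 : 0 ≤ ‖ŝ y‖ := norm_nonneg _
    have hey : 0 < Real.exp y := Real.exp_pos y
    have hwB : ‖ŵ y‖ ≤ B := by nlinarith
    have hsB : Real.exp y * ‖ŝ y‖ ≤ B := by linarith
    have hw2 : (ŵ y).re * (ŵ y).re + (ŵ y).im * (ŵ y).im ≤ B ^ 2 := by
      rw [← hnorm]; exact pow_le_pow_left₀ hw0 hwB 2
    have hs2 : Real.exp (2 * y) * ((ŝ y).re * (ŝ y).re + (ŝ y).im * (ŝ y).im) ≤ B ^ 2 := by
      have : Real.exp (2 * y) = Real.exp y ^ 2 := by rw [← Real.exp_nat_mul]; norm_num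
      rw [← hnorm, this, ← mul_pow]
      exact pow_le_pow_left₀ (by positivity) hsB 2
    have he4 : Real.exp (4 * y) = Real.exp (2 * y) * Real.exp (2 * y) := by
      rw [← Real.exp_add]; congr 1; ring
    have hBq0 : 0 ≤ (ŝ y).re * (ŝ y).re + (ŝ y).im * (ŝ y).im := add_nonneg (mul_self_nonneg _) (mul_self_nonneg _)
    have habs : |E y| ≤ 15 * B ^ 2 * (Real.exp (4 * y) + Real.exp (2 * y)) := by
      refine h.trans ?_
      have he2 : 0 < Real.exp (2 * y) := Real.exp_pos _
      have : Real.exp (4 * y) * (((ŵ y).re * (ŵ y).re + (ŵ y).im * (ŵ y).im) +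
          ((ŝ y).re * (ŝ y).re + (ŝ y).im * (ŝ y).im)) ≤ B ^ 2 * (Real.exp (4 * y) + Real.exp (2 * y)) := by
        rw [he4]
        nlinarith [mul_le_mul_of_nonneg_left hw2 (mul_pos he2 he2).le, mul_le_mul_of_nonneg_left hs2 he2.le]
      linarith
    have hcorr0 : 0 ≤ N ^ 2 * (Real.exp (5 * y) / 5 + 3 * Real.exp (3 * y)) / (X - 3) := by positivity
    have := neg_abs_le (E y)
    simp only [hG]
    linarith
  -- hence `G x ≥ 0`
  have hGx : 0 ≤ G x := by
    have hlim : Tendsto (fun y : ℝ => -(15 * B ^ 2 * (Real.exp (4 * y) + Real.exp (2 * y)))) atBot (𝓝 0) := by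
      have h4 := Real.tendsto_exp_atBot.comp (tendsto_id.const_mul_atBot (by norm_num : (0 : ℝ) < 4))
      have h2 := Real.tendsto_exp_atBot.comp (tendsto_id.const_mul_atBot (by norm_num : (0 : ℝ) < 2))
      have h := ((h4.add h2).const_mul (15 * B ^ 2)).neg
      simpa using h
    refine le_of_tendsto hlim ?_
    filter_upwards [eventually_le_atBot (min x 0)] with y hy
    have hyx : y ≤ x := hy.trans (min_le_left _ _)
    have hy0 : y ≤ 0 := hy.trans (min_le_right _ _)
    exact (hlow y hy0).trans (hmono (show y ∈ Iic (1 : ℝ) from hyx.trans hx) (show x ∈ Iic (1 : ℝ) from hx) hyx)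
  -- unpack `G x ≥ 0`
  have hEx : E x = Real.exp (5 * x) * (((W x - 1 + S x) * ‖ŵ x + 3 * ŝ x‖ ^ 2 +
      (W x - 1 - S x) * ‖ŵ x - 3 * ŝ x‖ ^ 2) / 2) := by
    simp only [hE]
    rw [energy_density_char]
  have hw : 0 < Real.exp (5 * x) := Real.exp_pos _
  have hGx' : 0 ≤ Real.exp (5 * x) * ((((W x - 1 + S x) * ‖ŵ x + 3 * ŝ x‖ ^ 2 +
      (W x - 1 - S x) * ‖ŵ x - 3 * ŝ x‖ ^ 2) / 2) + N ^ 2 * (1 / 5 + 3 * Real.exp (-2 * x)) / (X - 3)) := by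
    have he : Real.exp (5 * x) * (N ^ 2 * (1 / 5 + 3 * Real.exp (-2 * x)) / (X - 3)) =
        N ^ 2 * (Real.exp (5 * x) / 5 + 3 * Real.exp (3 * x)) / (X - 3) := by
      have h3 : Real.exp (3 * x) = Real.exp (5 * x) * Real.exp (-2 * x) := by
        rw [← Real.exp_add]; congr 1; ring
      rw [h3]; ring
    rw [mul_add, he, ← hEx]
    exact hGx
  have hfin := (mul_nonneg_iff_of_pos_left hw).mp hGx'
  have e2 : 2 * N ^ 2 * (1 / 5 + 3 * Real.exp (-2 * x)) / (X - 3) =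
      2 * (N ^ 2 * (1 / 5 + 3 * Real.exp (-2 * x)) / (X - 3)) := by ring
  rw [e2]
  linarith

end Summit.AtomisticToContinuum.HydrodynamicLimit.Theorems.SonicCavityRenewal

end
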